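import Summits.NavierStokesRegularity.FluidComputer.PalasekTowerGermHostPotentialAmplifier

/-!
# The germ host, XXIX: a FULLY NUMERIC composite design in the strict slot — end-to-end demonstration

Cell `ns-blowup`, seat `ns-blowup-ecbridge-3` (g5); GROUP C «BRIDGE SUPPORT» of the route
`PalasekTowerBreakdown` (crux `EpisodeBaseG`, item stmt-NavierStokesRegularity-19179, R2; line `slot` v5). Sequel of
`PalasekTowerGermHostPotentialAmplifier.lean` (amplifiers `curl A`, closed-form budget). LABEL: E–C typing
(KERNEL construction: one explicit potential — a definition with body — and its bookkeeping; everything proved).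
WHAT THIS IS NOT: not Navier–Stokes evidence and NOT a positive-direction design — a DEMONSTRATION that the numeric
amplifier chain composes with concrete numbers: carrier `strictTinyProfile (1/64)` plus a scaled copy of the far
pusher placed at `30 e₁`; its episode is as negative as every kernel host of record (tiny flat blob, slow swirls).
Nothing about any flow after `τ₀`, `FirstEpisodeD`, `RungG 1` or blow-up.

## What

* `demoPot x = ((Y₀/5) · ψ(x + 5e₃)) • e₃` (`ψ = pusherPot`, the far pusher's potential translated to the origin):
  smooth, `tsupport ⊆ B̄(0, 5/4)`, `‖D demoPot‖ ≤ (3/32) Y₀` (from `‖∇ψ‖ ≤ 15/32`);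
* the four numbers `(R, L, d, ‖c‖) = (5/4, (3/32)Y₀, 19, 30)`: `4L = (3/8)Y₀ < Y₀`, `7 + 19 + 5/4 < 30`, and the
  budget `(3/(2π·19⁴))·Y₀·((3/8)Y₀)²·(4π/3)(5/4)³ = (13500/3202768896)·Y₀³ < Y₀³/200000`;
* **`levelZeroData_demo : LevelZeroData (strictTinyProfile (1/64) + fun x => curl demoPot (x − 30 • e₁)) (125/4)`**
  — no hypothesis, no `Classical.choose`: the first composite (carrier + amplifier) strict-slot filler of the
  tree whose every constant is a numeral; host preparation of its germ schedule and the crux reduction for it by the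
  slot API (`hostPreparationD_demo`, `episodeBaseG_of_firstEpisodeD_demo`).

References: S. Palasek, arXiv:2605.13827 §3.3 [cite: Palasek2026ElementaryModel, §3.3].
-/

noncomputable section

namespace Summit.NavierStokesRegularity.FluidComputer.PalasekTowerClayBridge.Germ

open Set Function Filter Topology InnerProductSpace Metric MeasureTheory Real
open scoped Topology ContDiff RealInnerProductSpace

open Literature.Analysis.FluidPDE TinyBlob

/-! ## §1 The demonstration potential -/

/-- **The demonstration potential** `demoPot x = ((Y₀/5) · ψ(x + 5e₃)) • e₃`. [folklore] -/
def demoPot (x : EuclideanSpace ℝ (Fin 3)) : EuclideanSpace ℝ (Fin 3) :=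
  (TowerRates.wide.Y 0 / 5 * pusherPot (x + pusherCenter)) • e₃

/-- `demoPot` is smooth. [folklore] -/
theorem contDiff_demoPot : ContDiff ℝ ∞ demoPot :=
  (contDiff_const.mul (contDiff_pusherPot.comp (contDiff_id.add contDiff_const))).smul contDiff_const

/-- `tsupport demoPot ⊆ B̄(0, 5/4)` (`ψ` is supported in `B̄(5e₃, 5/4)`). [folklore] -/
theorem tsupport_demoPot_subset : tsupport demoPot ⊆ closedBall (0 : EuclideanSpace ℝ (Fin 3)) (5 / 4) := by
  refine closure_minimal (fun x hx => ?_) isClosed_closedBall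
  by_contra h
  refine hx ?_
  have hψ : pusherPot (x + pusherCenter) = 0 := by
    refine image_eq_zero_of_notMem_tsupport fun hmem => h ?_
    have := tsupport_pusherPot_subset hmem
    rw [mem_closedBall, dist_eq_norm, add_sub_cancel_right] at this
    rwa [mem_closedBall, dist_zero_right]
  simp [demoPot, hψ]

/-- The Jacobian of `demoPot`. [folklore] -/
theorem hasFDerivAt_demoPot (x : EuclideanSpace ℝ (Fin 3)) :
    HasFDerivAt demoPot
      (((TowerRates.wide.Y 0 / 5) • ((fderiv ℝ pusherPot (x + pusherCenter)).comp
        (ContinuousLinearMap.id ℝ (EuclideanSpace ℝ (Fin 3))))).smulRight e₃) x := by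
  have hg : HasFDerivAt (fun y => pusherPot (y + pusherCenter))
      ((fderiv ℝ pusherPot (x + pusherCenter)).comp (ContinuousLinearMap.id ℝ _)) x :=
    ((differentiable_pusherPot _).hasFDerivAt).comp x ((hasFDerivAt_id x).add_const pusherCenter)
  exact (hg.const_mul (TowerRates.wide.Y 0 / 5)).smul_const e₃

/-- **`‖D demoPot (x)‖ ≤ (3/32) Y₀`** (`‖∇ψ‖ ≤ 15/32`). [folklore] -/
theorem norm_fderiv_demoPot_le (x : EuclideanSpace ℝ (Fin 3)) :
    ‖fderiv ℝ demoPot x‖ ≤ 3 / 32 * TowerRates.wide.Y 0 := by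
  have hY := Host.wide_Y_zero_pos
  rw [(hasFDerivAt_demoPot x).fderiv, ContinuousLinearMap.norm_smulRight_apply, norm_e₃, mul_one, norm_smul,
    ContinuousLinearMap.comp_id, Real.norm_eq_abs, abs_of_pos (by positivity)]
  have hψ : ‖fderiv ℝ pusherPot (x + pusherCenter)‖ ≤ 15 / 32 := by
    have e : gradient pusherPot (x + pusherCenter) =
        (InnerProductSpace.toDual ℝ (EuclideanSpace ℝ (Fin 3))).symm (fderiv ℝ pusherPot (x + pusherCenter)) := rfl
    have h := norm_gradient_pusherPot_le (x + pusherCenter)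
    rwa [e, LinearIsometryEquiv.norm_map] at h
  calc TowerRates.wide.Y 0 / 5 * ‖fderiv ℝ pusherPot (x + pusherCenter)‖ ≤ TowerRates.wide.Y 0 / 5 * (15 / 32) :=
        mul_le_mul_of_nonneg_left hψ (by positivity)
    _ = 3 / 32 * TowerRates.wide.Y 0 := by ring

/-! ## §2 The numeric design -/

/-- `‖30 e₁‖ = 30`. [folklore] -/
theorem norm_thirty_smul_e₁ : ‖(30 : ℝ) • e₁‖ = 30 := by
  rw [norm_smul, show ‖e₁‖ = 1 by simp [e₁], mul_one, Real.norm_eq_abs]; norm_num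

/-- **The budget in numbers**: `(3/(2π·19⁴))·Y₀·((4·(3/32)Y₀)²·((5/4)³·(4π/3))) < Y₀³/200000`
(`= (13500/3202768896)·Y₀³ ≈ 4.22·10⁻⁶·Y₀³`). [folklore] -/
theorem demo_budget :
    3 / (2 * π * (19 : ℝ) ^ 4) * TowerRates.wide.Y 0 *
        ((4 * (3 / 32 * TowerRates.wide.Y 0)) ^ 2 * ((5 / 4 : ℝ) ^ 3 * (π * 4 / 3))) <
      TowerRates.wide.Y 0 ^ 3 / 200000 := by
  have hY := Host.wide_Y_zero_pos
  have hπ := Real.pi_pos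
  have e : 3 / (2 * π * (19 : ℝ) ^ 4) * TowerRates.wide.Y 0 *
      ((4 * (3 / 32 * TowerRates.wide.Y 0)) ^ 2 * ((5 / 4 : ℝ) ^ 3 * (π * 4 / 3))) =
      13500 / 3202768896 * TowerRates.wide.Y 0 ^ 3 := by
    field_simp
    ring
  rw [e]
  have hY3 : 0 < TowerRates.wide.Y 0 ^ 3 := by positivity
  have hc : (13500 / 3202768896 : ℝ) < 1 / 200000 := by norm_num
  calc (13500 / 3202768896 : ℝ) * TowerRates.wide.Y 0 ^ 3 < 1 / 200000 * TowerRates.wide.Y 0 ^ 3 :=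
        mul_lt_mul_of_pos_right hc hY3
    _ = TowerRates.wide.Y 0 ^ 3 / 200000 := by ring

/-- **THE FULLY NUMERIC COMPOSITE DESIGN FILLS THE STRICT SLOT**:
`LevelZeroData (strictTinyProfile (1/64) + fun x => curl demoPot (x − 30 • e₁)) (125/4)` — carrier scale `1/64`,
amplifier `curl demoPot` of Jacobian bound `L = (3/32)Y₀` in `B̄(0, 5/4)`, distance `d = 19`, centre `30 e₁`.
[cite: Palasek2026ElementaryModel, §3.3] -/
theorem levelZeroData_demo :
    LevelZeroData (strictTinyProfile (1 / 64) + fun x => curl demoPot (x - (30 : ℝ) • e₁)) (125 / 4) := by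
  have hY := Host.wide_Y_zero_pos
  have h := levelZeroData_strictTinyProfile_add_curl_of_le (a := 1 / 64) (by norm_num) (by norm_num)
    contDiff_demoPot tsupport_demoPot_subset (by norm_num : (0 : ℝ) ≤ 5 / 4) norm_fderiv_demoPot_le
    (by linarith : 4 * (3 / 32 * TowerRates.wide.Y 0) < TowerRates.wide.Y 0)
    (d := 19) (by rw [Host.wide_N_zero]; norm_num) (c := (30 : ℝ) • e₁) (by rw [norm_thirty_smul_e₁]; norm_num)
    demo_budget
  rw [norm_thirty_smul_e₁] at h
  norm_num at h
  exact h

/-- **Host preparation for the numeric design**: its germ schedule (radius `125/4`, `τ₀ = 1`, push `c₄`) is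
prepared in its singleton class. [cite: Palasek2026ElementaryModel, §3.3] -/
theorem hostPreparationD_demo {c₄ : ℝ} (hc₄ : 0 < c₄) (hc₄' : c₄ ≤ 1) :
    HostPreparationD (HostClass.exact (levelZeroData_demo.schedule c₄ hc₄ hc₄')) :=
  levelZeroData_demo.hostPreparationD_exact hc₄ hc₄'

/-- **… and the crux for the numeric design is its (presumably negative) episode.** [cite: Palasek2026ElementaryModel, §4] -/
theorem episodeBaseG_of_firstEpisodeD_demo {c₄ : ℝ} (hc₄ : 0 < c₄) (hc₄' : c₄ ≤ 1)
    (hF : FirstEpisodeD (HostClass.exact (levelZeroData_demo.schedule c₄ hc₄ hc₄'))) : EpisodeBaseG :=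
  levelZeroData_demo.episodeBaseG_of_firstEpisodeD hc₄ hc₄' hF

end Summit.NavierStokesRegularity.FluidComputer.PalasekTowerClayBridge.Germ

end
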